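import Summits.KontsevichZagierPeriods.KontsevichZagierPeriods.Theorems.LinRedNormalFormArrangementNormalFormSeparateTwoCornerLog

/-!
# Radial contraction towards a special point costs a logarithm

(Line `janus-bands`, crux `ArrangementNormalForm`, stub `stub_separateTwoPos`, part
`RadialLog`.) The radial sibling of part `CornerLog`: in blown-up coordinates `(x, v)` at a
special point (atom values `c₀ c + x (p c + q c v)`), for a fixed direction `|v| ≤ 1` and
`x' ≤ G/(28R)`, moving from the radius `x'` to `x ≤ x'` multiplies the fibre mass by at most
`(5 (1 + log(x'/x)))^{k·#U}` — `SepTwo.lmass_radial_log`, registered as `separateTwo_radialLog`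
(`SepTwo.lmass_contract` for the value clusters at the point, anchors `c₀`, factor `s = x/x'`,
buffer ratio `2`, `SepTwo.three_wexp_le`). USE (local integrability of the fibre mass at a
special point, needed for the Taylor pieces at FAR poles): with the Jacobian `x` of the blow-up,
`h(x) = x ∫ mass(x, v) dv` satisfies `h(s x') ≤ s (5(1 + log(1/s)))^{k·#U} h(x')`, which is
integrable in `s ∈ (0, 1)`; and `h(x') < ∞` for a.e. `x'` by the base-dimension-one fibre-mass
theorem `separateZero_fibreMass` applied to the vertical slice through `x'` (Tonelli). Hence the
fibre mass is integrable on every thin sector at the point — no upper-bound theory for the mass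
is required.
-/

noncomputable section

open Set MeasureTheory
open scoped ENNReal

namespace Summit.KontsevichZagierPeriods.ArrangementNormalForm.JanusBands

namespace SepTwo

variable {k : ℕ} {ι : Type*}

/-- **Radial contraction towards a special point costs a logarithm.** See the module docstring. -/
theorem lmass_radial_log (lo hi : Fin k → Fin k ⊕ ι) (a : Fin k → Option ι) (U : Finset ι)
    (hlo : ∀ i c, lo i = Sum.inr c → c ∈ U) (hhi : ∀ i c, hi i = Sum.inr c → c ∈ U)
    (ha : ∀ i c, a i = some c → c ∈ U) (c₀ p q : ι → ℝ) (G R : ℝ) (hR : 0 < R)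
    (hGsep : ∀ c ∈ U, ∀ c' ∈ U, c₀ c ≠ c₀ c' → G ≤ |c₀ c - c₀ c'|)
    (hRp : ∀ c ∈ U, |p c| ≤ R) (hRq : ∀ c ∈ U, |q c| ≤ R)
    {x x' v : ℝ} (hx : 0 < x) (hxx' : x ≤ x') (hx' : x' ≤ G / (28 * R)) (hv : |v| ≤ 1) :
    lmass lo hi a (fun c => c₀ c + x * (p c + q c * v)) ≤
      ENNReal.ofReal (5 * (1 + Real.log (x' / x))) ^ (k * U.card) *
        lmass lo hi a (fun c => c₀ c + x' * (p c + q c * v)) := by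
  have hx'0 : 0 < x' := lt_of_lt_of_le hx hxx'
  have hG28 : 28 * x' * R ≤ G := by
    have := (le_div_iff₀ (by positivity : (0 : ℝ) < 28 * R)).1 hx'; linarith
  set s : ℝ := x / x' with hs_def
  have hs0 : 0 < s := div_pos hx hx'0
  have hs1 : s ≤ 1 := (div_le_one hx'0).2 hxx'
  set ℓ : ℝ := 4 * x' * R with hℓ_def
  have hℓ : 0 < ℓ := by positivity
  have hw1 : 1 ≤ wexp ℓ (2 * ℓ) s := one_le_wexp ⟨hℓ, le_rfl, hs0, hs1⟩
  have hA1 : (1 : ℝ) ≤ 3 * wexp ℓ (2 * ℓ) s := by linarith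
  have hA5 : 3 * wexp ℓ (2 * ℓ) s ≤ 5 * (1 + Real.log (x' / x)) := by
    have := three_wexp_le hℓ hs0 hs1
    rwa [hs_def, inv_div] at this
  have h := lmass_contract lo hi a U hlo hhi ha (fun c => c₀ c + x' * (p c + q c * v))
    (fun c => c₀ c + x * (p c + q c * v)) c₀ s ℓ (2 * ℓ)
    (3 * wexp ℓ (2 * ℓ) s) hA1 ⟨hs0, hs1⟩ ⟨hℓ, le_rfl⟩ ?_ ?_ ?_
    (fun m => hwin_of_window hℓ le_rfl hs0 hs1 m)
  · calc lmass lo hi a (fun c => c₀ c + x * (p c + q c * v))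
        ≤ ENNReal.ofReal (3 * wexp ℓ (2 * ℓ) s) ^ (k * U.card) *
            lmass lo hi a (fun c => c₀ c + x' * (p c + q c * v)) := h
      _ ≤ ENNReal.ofReal (5 * (1 + Real.log (x' / x))) ^ (k * U.card) *
            lmass lo hi a (fun c => c₀ c + x' * (p c + q c * v)) := by
          gcongr
  · intro c hc
    show |c₀ c + x' * (p c + q c * v) - c₀ c| ≤ ℓ / 2
    have h1 : |p c + q c * v| ≤ 2 * R := by
      calc |p c + q c * v| ≤ |p c| + |q c * v| := abs_add_le _ _
        _ = |p c| + |q c| * |v| := by rw [abs_mul]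
        _ ≤ R + R * 1 := add_le_add (hRp c hc) (mul_le_mul (hRq c hc) hv (abs_nonneg _) hR.le)
        _ = 2 * R := by ring
    rw [show c₀ c + x' * (p c + q c * v) - c₀ c = x' * (p c + q c * v) by ring, abs_mul,
      abs_of_pos hx'0, hℓ_def]
    nlinarith
  · intro c hc c' hc' hne
    show 3 * (2 * ℓ) + ℓ ≤ |c₀ c - c₀ c'|
    rw [hℓ_def]
    linarith [hGsep c hc c' hc' hne]
  · intro c _
    show c₀ c + x * (p c + q c * v) = c₀ c + s * (c₀ c + x' * (p c + q c * v) - c₀ c)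
    rw [hs_def]
    field_simp
    ring

end SepTwo

/-- **Radial contraction towards a special point costs a logarithm** (registered part of
`stub_separateTwoPos`; literal form of `SepTwo.lmass_radial_log`): with the blow-up Jacobian `x`
and the base-dimension-one fibre-mass theorem on vertical slices this gives the local
integrability of the fibre mass on thin sectors at a special point (see the module docstring). -/
theorem separateTwo_radialLog (k : ℕ) (ι : Type) (lo hi : Fin k → Fin k ⊕ ι) (a : Fin k → Option ι) (U : Finset ι) (hlo : ∀ i c, lo i = Sum.inr c → c ∈ U) (hhi : ∀ i c, hi i = Sum.inr c → c ∈ U) (ha : ∀ i c, a i = some c → c ∈ U) (c₀ p q : ι → ℝ) (G R : ℝ) (hR : 0 < R) (hGsep : ∀ c ∈ U, ∀ c' ∈ U, c₀ c ≠ c₀ c' → G ≤ |c₀ c - c₀ c'|) (hRp : ∀ c ∈ U, |p c| ≤ R) (hRq : ∀ c ∈ U, |q c| ≤ R) (x x' v : ℝ) (hx : 0 < x) (hxx' : x ≤ x') (hx' : x' ≤ G / (28 * R)) (hv : |v| ≤ 1) : MeasureTheory.lintegral (MeasureTheory.volume.restrict {t : Fin k → ℝ | ∀ i, Sum.elim t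 (fun c => c₀ c + x * (p c + q c * v)) (lo i) < t i ∧ t i < Sum.elim t (fun c => c₀ c + x * (p c + q c * v)) (hi i)}) (fun t => ∏ i, (a i).elim 1 (fun c => ENNReal.ofReal |t i - (c₀ c + x * (p c + q c * v))|⁻¹)) ≤ ENNReal.ofReal (5 * (1 + Real.log (x' / x))) ^ (k * U.card) * MeasureTheory.lintegral (MeasureTheory.volume.restrict {t : Fin k → ℝ | ∀ i, Sum.elim t (fun c => c₀ c + x' * (p c + q c * v)) (lo i) < t i ∧ t i < Sum.elim t (fun c => c₀ c + x' * (p c + q c * v)) (hi i)}) (fun t => ∏ i, (a i).elim 1 (fun c => ENNReal.ofReal |t i - (c₀ c + x' * (p c + q c * v))|⁻¹)) := by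
  exact SepTwo.lmass_radial_log lo hi a U hlo hhi ha c₀ p q G R hR hGsep hRp hRq hx hxx' hx' hv

end Summit.KontsevichZagierPeriods.ArrangementNormalForm.JanusBands
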